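import Literature.MathematicalPhysics.QuantumLattice.GibbsLogPartitionTemperatureCouplingConvexity
import HarnessLib

/-!
# The thermal directional row in SCALED couplings and the thermal APEX row of the canonical sector of the
# `t–t'` Hubbard torus: one-body energies at the apex hopping are monotone along rays of `(t', U, T)`-space

Topic `Literature/MathematicalPhysics/QuantumLattice` (thermal toolkit; companion of
`GibbsLogPartitionTemperatureCouplingConvexity` and of the `T = 0` file `HubbardTTPrimeApexRow`). Written for the
MO-S1/S2 seam of the Hubbard material oracle (cell `pub/hubbard-downfold`, row "robustness lemmas: monotonicity /
Lipschitz of certified words in `(t', U, μ)` — and `T` — so a parameter BOX maps to ONE certified word", seat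
`hubbard-downfold-unc-2`). Finite volume, canonical `(rectN n L, S^z = 0)` sector; everything PROVED; no definition,
no named fact, no number.

The joint tangent plane of `GibbsLogPartitionTemperatureCouplingConvexity`
(`log_partitionFn_sectorHamiltonianTT'_ge_tangent_temperature`: `log Z` is convex in the SCALED couplings
`θ = β·(t, s, U)`, slope `−⟨(K₁, K₂, D)|_sector⟩_{β,H}`) written twice — anchor `(β₀; t₀, s₀, U₀)` at the target
`(β; t, s, U)` and conversely — and added gives

* §1 `gibbsState_sectorHamiltonianTT'_directional_le_temperature` — **the thermal directional row in scaled
  couplings**: `(βt − β₀t₀)·Δ⟨K₁⟩ + (βs − β₀s₀)·Δ⟨K₂⟩ + (βU − β₀U₀)·Δ⟨D⟩ ≤ 0`, `Δ = ⟨·⟩_{β,(t,s,U)} − ⟨·⟩_{β₀,(t₀,s₀,U₀)}`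
  (the thermal Gibbs expectations of the sector-compressed nearest-neighbour hopping, diagonal hopping and double
  occupancy are a monotone map of `θ`; at `β = β₀` the `T > 0` twin of `directional3_le_of_cross_variational`).
* §2 `gibbsState_sectorHamiltonianTT'_apex_le_temperature` — **the thermal APEX row**: if the scaled on-site couplings
  agree, `β·U = β₀·U₀` (`0 ≤ U₀ < U`, `β₀ > 0`: the target at larger `U` is HOTTER by the factor `U/U₀`), the on-site
  term drops out and the thermal one-body energy at the apex hopping `κ = (U s₀ − U₀ s)/(U − U₀)` — the
  `s`-intercept of the line through `(s₀, U₀)` and `(s, U)` at `U = 0` — is non-decreasing from the anchor to the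
  target: `t⟨K₁⟩₀ + κ⟨K₂⟩₀ ≤ t⟨K₁⟩ + κ⟨K₂⟩`. In `(s, U, T)`-space the anchor, the target and the apex `(κ, 0, 0)` are
  COLLINEAR (`T/U = T₀/U₀`): thermal one-body energies at the apex hopping are monotone along every ray leaving the
  apex. `gibbsState_sectorHamiltonianTT'_twice_hopping_le_temperature` — the doubled-hopping case `U s₀ = (2U − U₀) s`
  (`κ = 2s`, the `t–t'` f-sum weight).

Reading (why it is here): a thermal one-body / f-sum word certified at `(s₀, U₀, T₀)` bounds the same functional at
`(s, U, T₀·U/U₀)` on the apex line; a bound UNIFORM in `T₀` at the anchor transports to a bound uniform in `T` at the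
target (the map `T₀ ↦ T₀U/U₀` is onto), which is the hypothesis shape of the thermal stiffness leaf
`ObsThermalStiffnessSeqCeilingAt` (Summits `Observables/StiffnessThermalLeaf`). No torus limit is taken here.

HONEST SCOPE: finite tori; transport of Gibbs expectations only; nothing flows toward smaller `U` at fixed
temperature ratio; no certificate, no thermodynamic limit, no phase sentence.

## Mathlib / tree search
REUSED: `log_partitionFn_sectorHamiltonianTT'_ge_tangent_temperature` (both directions). `lean search
'directional.*temperature|apex'`: only the `T = 0` apex rows (`HubbardTTPrimeApexRow`) and the single tangent plane.

## References
* R. B. Israel, *Convexity in the Theory of Lattice Gases* (1979), Thm. I.3.4 (joint convexity of the pressure in the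
  interaction, temperature absorbed). [cite: Israel1979, Thm. I.3.4]
* E. H. Lieb, Commun. Math. Phys. 31 (1973) 327, §V (5.2)–(5.4) (Peierls–Bogoliubov tangent). [cite: Lieb1973, §V (5.2)–(5.4)]
* T. Koma, H. Tasaki, J. Stat. Phys. 76 (1994) 745, §1 (conjugate observables of linear couplings). [cite: KomaTasaki1994, §1]
-/

noncomputable section

open scoped Matrix.Norms.L2Operator ComplexOrder BigOperators
open Matrix Finset

namespace Literature.MathematicalPhysics.QuantumLattice

section Hubbard

open HubbardWave0

variable (L : ℕ)

/-! ### §1 The thermal directional row in scaled couplings -/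

/-- **Thermal directional row in scaled couplings (canonical sector, finite torus).** For `0 ≤ n ≤ 2` and any two
temperature × coupling points `(β₀; t₀, s₀, U₀)`, `(β; t, s, U)`:
`(βt − β₀t₀)(⟨K₁⟩ − ⟨K₁⟩₀) + (βs − β₀s₀)(⟨K₂⟩ − ⟨K₂⟩₀) + (βU − β₀U₀)(⟨D⟩ − ⟨D⟩₀) ≤ 0`, the expectations being the thermal
Gibbs expectations of the sector-compressed unit nearest-neighbour hopping, unit diagonal hopping and double-occupancy operators
at the two points — the two joint tangent planes of `log Z` added. [cite: Israel1979, Thm. I.3.4] [cite: Lieb1973, §V (5.2)–(5.4)] -/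
theorem gibbsState_sectorHamiltonianTT'_directional_le_temperature {nf : ℝ} (hn0 : 0 ≤ nf) (hn2 : nf ≤ 2)
    (β β₀ t s U t₀ s₀ U₀ : ℝ) :
    (β * t - β₀ * t₀) *
        ((gibbsState β (sectorHamiltonianTT' t s U nf L)
            ((hamiltonian (fermionTorusGraph 2 L) 1 0).submatrix
              (Subtype.val : Subtype (szConfig nf L) → _) Subtype.val)).re -
          (gibbsState β₀ (sectorHamiltonianTT' t₀ s₀ U₀ nf L)
            ((hamiltonian (fermionTorusGraph 2 L) 1 0).submatrix
              (Subtype.val : Subtype (szConfig nf L) → _) Subtype.val)).re) +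
      (β * s - β₀ * s₀) *
        ((gibbsState β (sectorHamiltonianTT' t s U nf L)
            ((hamiltonian (fermionTorusDiagGraph L) 1 0).submatrix
              (Subtype.val : Subtype (szConfig nf L) → _) Subtype.val)).re -
          (gibbsState β₀ (sectorHamiltonianTT' t₀ s₀ U₀ nf L)
            ((hamiltonian (fermionTorusDiagGraph L) 1 0).submatrix
              (Subtype.val : Subtype (szConfig nf L) → _) Subtype.val)).re) +
      (β * U - β₀ * U₀) *
        ((gibbsState β (sectorHamiltonianTT' t s U nf L)
            ((∑ x : FermionTorus 2 L, numberOp x 0 * numberOp x 1).submatrix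
              (Subtype.val : Subtype (szConfig nf L) → _) Subtype.val)).re -
          (gibbsState β₀ (sectorHamiltonianTT' t₀ s₀ U₀ nf L)
            ((∑ x : FermionTorus 2 L, numberOp x 0 * numberOp x 1).submatrix
              (Subtype.val : Subtype (szConfig nf L) → _) Subtype.val)).re) ≤ 0 := by
  have h1 := log_partitionFn_sectorHamiltonianTT'_ge_tangent_temperature L hn0 hn2 β β₀ t s U t₀ s₀ U₀
  have h2 := log_partitionFn_sectorHamiltonianTT'_ge_tangent_temperature L hn0 hn2 β₀ β t₀ s₀ U₀ t s U
  nlinarith [h1, h2]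

/-! ### §2 The thermal apex row: equal scaled on-site couplings -/

/-- **Thermal APEX row (canonical sector, finite torus).** `0 ≤ n ≤ 2`, `0 ≤ U₀ < U`, `0 < β₀`, and `β·U = β₀·U₀` (the target at the
larger coupling is hotter by `U/U₀`; same `t`). Then with the apex hopping `κ = (U s₀ − U₀ s)/(U − U₀)` (the `s`-intercept at `U = 0` of
the line through `(s₀, U₀)` and `(s, U)`): `t⟨K₁⟩_{β₀,(t,s₀,U₀)} + κ⟨K₂⟩_{β₀,(t,s₀,U₀)} ≤ t⟨K₁⟩_{β,(t,s,U)} + κ⟨K₂⟩_{β,(t,s,U)}` — the thermal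
one-body energy at the apex hopping is non-decreasing along the ray from the apex `(κ, U = 0, T = 0)` through the two points of
`(s, U, T)`-space. (§1 with the on-site increment `βU − β₀U₀ = 0` and `βs − β₀s₀ = (β − β₀)κ`, divided by `β − β₀ < 0`.)
[cite: Israel1979, Thm. I.3.4] [cite: KomaTasaki1994, §1] -/
theorem gibbsState_sectorHamiltonianTT'_apex_le_temperature {nf : ℝ} (hn0 : 0 ≤ nf) (hn2 : nf ≤ 2)
    {β β₀ t s U s₀ U₀ : ℝ} (hU₀ : 0 ≤ U₀) (hU : U₀ < U) (hβ₀ : 0 < β₀) (hθ : β * U = β₀ * U₀) :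
    t * (gibbsState β₀ (sectorHamiltonianTT' t s₀ U₀ nf L)
            ((hamiltonian (fermionTorusGraph 2 L) 1 0).submatrix
              (Subtype.val : Subtype (szConfig nf L) → _) Subtype.val)).re +
        (U * s₀ - U₀ * s) / (U - U₀) *
          (gibbsState β₀ (sectorHamiltonianTT' t s₀ U₀ nf L)
            ((hamiltonian (fermionTorusDiagGraph L) 1 0).submatrix
              (Subtype.val : Subtype (szConfig nf L) → _) Subtype.val)).re ≤
      t * (gibbsState β (sectorHamiltonianTT' t s U nf L)
            ((hamiltonian (fermionTorusGraph 2 L) 1 0).submatrix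
              (Subtype.val : Subtype (szConfig nf L) → _) Subtype.val)).re +
        (U * s₀ - U₀ * s) / (U - U₀) *
          (gibbsState β (sectorHamiltonianTT' t s U nf L)
            ((hamiltonian (fermionTorusDiagGraph L) 1 0).submatrix
              (Subtype.val : Subtype (szConfig nf L) → _) Subtype.val)).re := by
  have hd : U - U₀ ≠ 0 := ne_of_gt (sub_pos.2 hU)
  have hUpos : 0 < U := hU₀.trans_lt hU
  have hβlt : β < β₀ := by
    have h1 : β * U < β₀ * U := by
      rw [hθ]
      exact mul_lt_mul_of_pos_left hU hβ₀
    exact lt_of_mul_lt_mul_right h1 hUpos.le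
  have hdir := gibbsState_sectorHamiltonianTT'_directional_le_temperature L hn0 hn2 β β₀ t s U t s₀ U₀
  rw [sub_eq_zero.2 hθ, zero_mul, add_zero] at hdir
  -- `βs − β₀s₀ = (β − β₀)·κ`
  have hκ : β * s - β₀ * s₀ = (β - β₀) * ((U * s₀ - U₀ * s) / (U - U₀)) := by
    rw [mul_div_assoc', eq_div_iff hd]
    linear_combination (s - s₀) * hθ
  rw [hκ, show β * t - β₀ * t = (β - β₀) * t by ring] at hdir
  -- divide by `β − β₀ < 0`
  have hneg : 0 < β₀ - β := sub_pos.2 hβlt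
  have key : 0 ≤ (β₀ - β) *
      (t * ((gibbsState β (sectorHamiltonianTT' t s U nf L)
            ((hamiltonian (fermionTorusGraph 2 L) 1 0).submatrix
              (Subtype.val : Subtype (szConfig nf L) → _) Subtype.val)).re -
          (gibbsState β₀ (sectorHamiltonianTT' t s₀ U₀ nf L)
            ((hamiltonian (fermionTorusGraph 2 L) 1 0).submatrix
              (Subtype.val : Subtype (szConfig nf L) → _) Subtype.val)).re) +
        (U * s₀ - U₀ * s) / (U - U₀) *
          ((gibbsState β (sectorHamiltonianTT' t s U nf L)
            ((hamiltonian (fermionTorusDiagGraph L) 1 0).submatrix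
              (Subtype.val : Subtype (szConfig nf L) → _) Subtype.val)).re -
          (gibbsState β₀ (sectorHamiltonianTT' t s₀ U₀ nf L)
            ((hamiltonian (fermionTorusDiagGraph L) 1 0).submatrix
              (Subtype.val : Subtype (szConfig nf L) → _) Subtype.val)).re)) := by
    nlinarith [hdir]
  have := (mul_nonneg_iff_of_pos_left hneg).1 key
  linarith

/-- **Doubled-hopping thermal apex row.** Under the hypotheses of `gibbsState_sectorHamiltonianTT'_apex_le_temperature` and
`U·s₀ = (2U − U₀)·s` (the anchor lies on the segment from the apex `(2s, 0)` to the target `(s, U)`), the apex hopping is `2s`: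
`t⟨K₁⟩₀ + 2s⟨K₂⟩₀ ≤ t⟨K₁⟩ + 2s⟨K₂⟩` — the thermal one-body energy carrying the `t–t'` f-sum weights of the TARGET is non-decreasing from the
anchor `(β₀; s₀, U₀)` to the hotter target `(β₀U₀/U; s, U)`. [cite: Israel1979, Thm. I.3.4] [cite: KomaTasaki1994, §1] -/
theorem gibbsState_sectorHamiltonianTT'_twice_hopping_le_temperature {nf : ℝ} (hn0 : 0 ≤ nf) (hn2 : nf ≤ 2)
    {β β₀ t s U s₀ U₀ : ℝ} (hU₀ : 0 ≤ U₀) (hU : U₀ < U) (hβ₀ : 0 < β₀) (hθ : β * U = β₀ * U₀)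
    (hapex : U * s₀ = (2 * U - U₀) * s) :
    t * (gibbsState β₀ (sectorHamiltonianTT' t s₀ U₀ nf L)
            ((hamiltonian (fermionTorusGraph 2 L) 1 0).submatrix
              (Subtype.val : Subtype (szConfig nf L) → _) Subtype.val)).re +
        2 * s *
          (gibbsState β₀ (sectorHamiltonianTT' t s₀ U₀ nf L)
            ((hamiltonian (fermionTorusDiagGraph L) 1 0).submatrix
              (Subtype.val : Subtype (szConfig nf L) → _) Subtype.val)).re ≤
      t * (gibbsState β (sectorHamiltonianTT' t s U nf L)
            ((hamiltonian (fermionTorusGraph 2 L) 1 0).submatrix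
              (Subtype.val : Subtype (szConfig nf L) → _) Subtype.val)).re +
        2 * s *
          (gibbsState β (sectorHamiltonianTT' t s U nf L)
            ((hamiltonian (fermionTorusDiagGraph L) 1 0).submatrix
              (Subtype.val : Subtype (szConfig nf L) → _) Subtype.val)).re := by
  have hd : U - U₀ ≠ 0 := ne_of_gt (sub_pos.2 hU)
  have e : (U * s₀ - U₀ * s) / (U - U₀) = 2 * s := by
    rw [div_eq_iff hd, hapex]
    ring
  have h := gibbsState_sectorHamiltonianTT'_apex_le_temperature L hn0 hn2 (t := t) (s := s) (s₀ := s₀) hU₀ hU hβ₀ hθ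
  rwa [e] at h

end Hubbard

end Literature.MathematicalPhysics.QuantumLattice

end
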